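import Summits.HodgeConjecture.CorCM.HypLiu418.A3Liu418GSCentralPlug
import HarnessLib

/-!
# GS-6 glue, the PLUG TAIL `(M, q, hfac)` of the face decomposition package, generic behind an abstract cast

Cell hodgecm-mathlib (D-0151), crux `HLiu418` (stmt-HodgeConjecture-24832), line `a3_liu418`, the (β) hoist of [Liu2021, Thm. D.6 (1)]
(SPEC `A-plan/GS6-HOIST-SPEC.md` §9; placement row S-4δ).  Namespace `Summit.HodgeConjecture.CorCM.Lines.A3Liu418`; sequel of
`A3Liu418GSCentralPlug` (the G2c plug at the adapted split face: `plugRho₁/₂`, `plugChi`, `plugPhi`, `plugE`, `plugRho`, `plugRho'`,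
`exists_factor_slice_mem_omegaHom_plug'`).  THEOREMS ONLY (no definition, no named fact, no instance, no `sorry`).

What is proved, generically over the plug's own data `(S, …, N₁ N₂ eV e₁ e₂ J₁ J₂, …, a, s/s₁f/s₂, hχV, χface, θ)` and an ABSTRACT
identification `C : X ≃ₗ[ℂ] Coinv (ω_f[J₁ ⊕ᶠ J₂] ⇂ U(⟨a⟩)) χ_W` of some `U(J⋆)(𝔸_f)`-module `X` intertwining `ρ_X` with the plug
representation `ω_χ ∘ (· ⊕ᶠ 1) ∘ θ` (`hC`):

* `exists_factor_slice_mem_omegaHom_cast` — per occurring central character `ψ`: for `f′ ∈ Hom_{U(J⋆)}(ι′ ∘ ρ_X, ℚ_ℓ^{ac} ⊗ H¹_ét)`,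
  `p_ψ ∘ f′ = g ∘ ((plugE ⊗ 1) ∘ q_ψ̃ ∘ Φ_plug ∘ C)` with every slice `u ↦ g (u ⊗ m)` in `Hom(ι′ ∘ (rhoVAtLine[J₁] … a ψ̃ ∘ θ), …)`
  (= `exists_factor_slice_mem_omegaHom_plug'` applied to `f′ ∘ C⁻¹`);
* `exists_plugTail` — the packaged tail `∃ (M : OccWeight … → ModuleCat ℂ) (q : ∀ i, X →ₗ[ℂ] ω⋆(a, χ_i) ⊗ M i), ∀ i, ∀ f′, ∃ g, …`
  of `DecompositionAtFaceAdapted` (`A3Liu418GSThmD6OneCurve`), with `M i := Coinv (ω_f[J₂] through the line) (χ″·ψ̃ᵢ⁻¹)` and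
  `q i := ((plugE ⊗ 1) ∘ q_ψ̃ᵢ ∘ Φ_plug) ∘ C`.

At the GS face (`A3Liu418GSFrobeniusOfThmD6`) `X := ω_{D′}(ν, ε′, χ′)` (the `UniformOmega` spelling of the adapted face model) and `C`
is `exists_omegaFaceCast` (`A3Liu418GSOmegaFaceCast`); stating the tail over an ABSTRACT `X` keeps the face model's module instances out
of every `LinearMap` built here, and stating the per-label step with a SMALL goal keeps the plug's 36-argument application out of the
`∃ M q` goal (both measured necessary: the direct forms exceed 6.4 M heartbeats at `whnf`).
HC_CM is proved only modulo the 7 printed citations until rung 0 closes; nothing of [Liu2021] is asserted here.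

References: [Liu2021] Y. Liu, *Fourier–Jacobi cycles and arithmetic relative trace formula*, Camb. J. Math. 9 (2021) = arXiv:2102.11518,
proof of Thm. 4.15 (FJcycle.tex l. 2199–2212), App. D §D.1 Step 3 (l. 5221); [GelbartRogawski1991] S. Gelbart, J. Rogawski,
*L-functions and Fourier–Jacobi coefficients for the unitary group U(3)*, Invent. Math. 105 (1991), §3.1 Prop. 3.1.1 p. 455.

PRE-SPLIT (director hodgecm-mathlib s168 (1)(d) ∕ A-plan1 (g12) 18:24:37Z rule «> 150 CPU-s ⇒ pieces ≤ 150 before filing»; cutter A-p18 (g10)): this module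
`A3Liu418GSCentralPlugTailCast` carries `exists_factor_slice_mem_omegaHom_cast` ALONE (≈ 80–150 CPU-s synchronous on the farm) and the sequel
`A3Liu418GSCentralPlugTail` carries `exists_plugTail` (≈ 90 CPU-s); declarations BYTE-IDENTICAL to A-p19 (g10)՚s report-first e893fc5872862207, same namespace,
same variable block, unchanged fully-qualified names (imports the S-3b module `A3Liu418GSCentralPlug` unchanged — operator-split/shim shape).
-/

set_option autoImplicit false

noncomputable section

namespace Summit.HodgeConjecture.CorCM.Lines.A3Liu418

open CategoryTheory NumberField IsDedekindDomain
open scoped TensorProduct Classical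
open Literature.AlgebraicGeometry.Motives
open Literature.AlgebraicGeometry.ShimuraVarieties.UnitaryCanonicalModel
open Literature.NumberTheory.Automorphic Literature.NumberTheory.Automorphic.UnitaryGroup
open Literature.NumberTheory.Automorphic.Liu2021 Literature.NumberTheory.Automorphic.Liu2021.AppendixC
open Summit.HodgeConjecture.CorCM.Model Summit.HodgeConjecture.CorCM.Model.HComp
open Literature.RepresentationTheory Literature.RepresentationTheory.TwistedCoinv
open Literature.NumberTheory.GelbartRogawski1991 Literature.NumberTheory.GelbartRogawski1991.UnitaryDualPair
open Literature.NumberTheory.GelbartRogawski1991.UnitaryDualPair.WeilCoinv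
open Literature.NumberTheory.Weil1964

section G2cPlugTail

variable {F : CMField} {ι₁ : F →+* ℂ} {Jstar : Matrix (Fin 2) (Fin 2) F}
  {K₀ : C5.OpenCompactSubgroup ↥(finAdelic (↥(maximalRealSubfield F)) F (IsCMField.complexConj F) 2 Jstar)}
  (S : RecordSystemGS F Jstar ι₁ K₀)
  (hU7ₛ : S.HeckeTranslateDefinedOver) (hLQ : S.IsLevelQuotient) (h4 : 4 ≤ Module.finrank ℚ F) (isoₛ : ℕ → Prop)
  (ℓ : ℕ) [Fact ℓ.Prime] (ι' : ℂ ≃+* AlgebraicClosure ℚ_[ℓ])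
  -- (f1-adapted) data at `(F⁺, F, c̄)`, `M := 1`, `J_W := JW a`
  (N₁ N₂ : ℕ) {n n₁ n₂ : ℕ}
  (eV : Fin (N₁ + N₂) × Fin 1 ≃ Fin n) (e₁ : Fin N₁ × Fin 1 ≃ Fin n₁) (e₂ : Fin N₂ × Fin 1 ≃ Fin n₂)
  (J₁ : Matrix (Fin N₁) (Fin N₁) (F : Type)) (J₂ : Matrix (Fin N₂) (Fin N₂) (F : Type))
  {T₁ : Matrix (Fin N₁) (Fin N₁) ↥(maximalRealSubfield (F : Type))} {T₂ : Matrix (Fin N₂) (Fin N₂) ↥(maximalRealSubfield (F : Type))}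
  {δ : (F : Type)} (hcδ : (IsCMField.complexConj (F : Type)) δ = -δ) (hδ : δ ≠ 0) {d : ↥(maximalRealSubfield (F : Type))} (hd : δ * δ = algebraMap ↥(maximalRealSubfield (F : Type)) (F : Type) d)
  (h₁ : T₁.IsSymm) (h₂ : T₂.IsSymm) (h₁d : IsUnit T₁.det) (h₂d : IsUnit T₂.det) (hVd : IsUnit (finSum N₁ N₂ T₁ T₂).det)
  (hJ₁ : J₁ = T₁.map (algebraMap ↥(maximalRealSubfield (F : Type)) (F : Type))) (hJ₂ : J₂ = T₂.map (algebraMap ↥(maximalRealSubfield (F : Type)) (F : Type)))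
  (a : (↥(maximalRealSubfield (F : Type)))ˣ)
  {s : ↥(adelicPair ↥(maximalRealSubfield (F : Type)) (F : Type) (IsCMField.complexConj (F : Type)) (N₁ + N₂) 1 (finSum N₁ N₂ J₁ J₂) (Def411WeilCarriers.JW ↥(maximalRealSubfield (F : Type)) (F : Type) a)) →*
    adelicMpCont ↥(maximalRealSubfield (F : Type)) (Fin n) (adelicGram ↥(maximalRealSubfield (F : Type)) eV (finSum N₁ N₂ T₁ T₂) (Def411WeilCarriers.TW ↥(maximalRealSubfield (F : Type)) a))}
  {s₁f : ∀ b : (↥(maximalRealSubfield (F : Type)))ˣ, ↥(adelicPair ↥(maximalRealSubfield (F : Type)) (F : Type) (IsCMField.complexConj (F : Type)) N₁ 1 J₁ (Def411WeilCarriers.JW ↥(maximalRealSubfield (F : Type)) (F : Type) b)) →*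
    adelicMpCont ↥(maximalRealSubfield (F : Type)) (Fin n₁) (adelicGram ↥(maximalRealSubfield (F : Type)) e₁ T₁ (Def411WeilCarriers.TW ↥(maximalRealSubfield (F : Type)) b))}
  {s₂ : ↥(adelicPair ↥(maximalRealSubfield (F : Type)) (F : Type) (IsCMField.complexConj (F : Type)) N₂ 1 J₂ (Def411WeilCarriers.JW ↥(maximalRealSubfield (F : Type)) (F : Type) a)) →*
    adelicMpCont ↥(maximalRealSubfield (F : Type)) (Fin n₂) (adelicGram ↥(maximalRealSubfield (F : Type)) e₂ T₂ (Def411WeilCarriers.TW ↥(maximalRealSubfield (F : Type)) a))}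
  (hs : (splittingDatum ↥(maximalRealSubfield (F : Type)) (F : Type) (IsCMField.complexConj (F : Type)) (N₁ + N₂) 1 eV (finSum N₁ N₂ J₁ J₂) (Def411WeilCarriers.JW ↥(maximalRealSubfield (F : Type)) (F : Type) a) hcδ hδ hd
    (isSymm_finSum h₁ h₂) (Def411WeilCarriers.isSymm_TW ↥(maximalRealSubfield (F : Type)) a) hVd (Def411WeilCarriers.isUnit_det_TW ↥(maximalRealSubfield (F : Type)) a)
    (finSum_eq_map_finSum ↥(maximalRealSubfield (F : Type)) (F : Type) N₁ N₂ J₁ J₂ hJ₁ hJ₂) (Def411WeilCarriers.JW_eq ↥(maximalRealSubfield (F : Type)) (F : Type) a)).IsCompatible s)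
  (hs₁f : ∀ b : (↥(maximalRealSubfield (F : Type)))ˣ, (splittingDatum ↥(maximalRealSubfield (F : Type)) (F : Type) (IsCMField.complexConj (F : Type)) N₁ 1 e₁ J₁ (Def411WeilCarriers.JW ↥(maximalRealSubfield (F : Type)) (F : Type) b) hcδ hδ hd h₁
    (Def411WeilCarriers.isSymm_TW ↥(maximalRealSubfield (F : Type)) b) h₁d (Def411WeilCarriers.isUnit_det_TW ↥(maximalRealSubfield (F : Type)) b) hJ₁
    (Def411WeilCarriers.JW_eq ↥(maximalRealSubfield (F : Type)) (F : Type) b)).IsCompatible (s₁f b))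
  (hs₂ : (splittingDatum ↥(maximalRealSubfield (F : Type)) (F : Type) (IsCMField.complexConj (F : Type)) N₂ 1 e₂ J₂ (Def411WeilCarriers.JW ↥(maximalRealSubfield (F : Type)) (F : Type) a) hcδ hδ hd h₂
    (Def411WeilCarriers.isSymm_TW ↥(maximalRealSubfield (F : Type)) a) h₂d (Def411WeilCarriers.isUnit_det_TW ↥(maximalRealSubfield (F : Type)) a) hJ₂
    (Def411WeilCarriers.JW_eq ↥(maximalRealSubfield (F : Type)) (F : Type) a)).IsCompatible s₂)
  (hχV : ∀ g₁ : ↥(adelic ↥(maximalRealSubfield (F : Type)) (F : Type) (IsCMField.complexConj (F : Type)) N₁ J₁), mpSeesawCharLeft ↥(maximalRealSubfield (F : Type)) (F : Type) (IsCMField.complexConj (F : Type)) N₁ N₂ 1 eV e₁ e₂ J₁ J₂ (Def411WeilCarriers.JW ↥(maximalRealSubfield (F : Type)) (F : Type) a) hcδ hδ hd h₁ h₂ (Def411WeilCarriers.isSymm_TW ↥(maximalRealSubfield (F : Type)) a) h₁d h₂d (Def411WeilCarriers.isUnit_det_TW ↥(maximalRealSubfield (F : Type)) a) hVd hJ₁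 hJ₂ (Def411WeilCarriers.JW_eq ↥(maximalRealSubfield (F : Type)) (F : Type) a) hs (hs₁f a) hs₂ ((g₁, 1), 1) = 1)
  (χface : Def411WeilCarriers.Chi ↥(maximalRealSubfield (F : Type)) (F : Type) (IsCMField.complexConj (F : Type)))
  (θ : ↥(finAdelic (↥(maximalRealSubfield F)) F (IsCMField.complexConj F) 2 Jstar) →* ↥(finAdelic ↥(maximalRealSubfield (F : Type)) (F : Type) (IsCMField.complexConj (F : Type)) N₁ J₁))

set_option maxHeartbeats 6400000 in -- measured (1.6 M, 3.2 M] (statement `whnf`) in the by-paste harness (A-p19 (g10) O5, 2× envelope)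
include e₂ h₂d hs₂ hχV in
/-- **The per-label factorisation behind an abstract cast** (A-p12՚s `exists_factor_slice_mem_omegaHom_plug′` read through `C : X ≃ Dom`): for an
occurring central character `ψ` and `f′ ∈ Hom_{U(J⋆)}(ι′ ∘ ρ_X, ℚ_ℓ^{ac} ⊗ H¹_ét)`, `p_ψ ∘ f′ = g ∘ ((plugE ⊗ 1) ∘ q_ψ̃ ∘ Φ_plug ∘ C)` with slices in
`Hom(ι′ ∘ (rhoVAtLine[J₁] … a ψ̃ ∘ θ), …)`.  Small statement on purpose (the `∃ M q` packaging is `exists_plugTail`).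
[cite: Liu2021, proof of Thm. 4.15 (FJcycle.tex l. 2199–2212); App. D §D.1 Step 3 (l. 5221)] -/
theorem exists_factor_slice_mem_omegaHom_cast
    (hθ : ∀ z : ↥(finAdelicOne ↥(maximalRealSubfield (F : Type)) (F : Type) (IsCMField.complexConj (F : Type))), θ (finAdelicCenter ↥(maximalRealSubfield (F : Type)) (F : Type) (IsCMField.complexConj (F : Type)) 2 Jstar z) = finAdelicCenter ↥(maximalRealSubfield (F : Type)) (F : Type) (IsCMField.complexConj (F : Type)) N₁ J₁ z)
    {X : Type} [AddCommGroup X] [Module ℂ X]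
    (ρX : Representation ℂ ↥(finAdelic (↥(maximalRealSubfield F)) F (IsCMField.complexConj F) 2 Jstar) X)
    (C : X ≃ₗ[ℂ] Coinv (finPairRepW ↥(maximalRealSubfield (F : Type)) (F : Type) (IsCMField.complexConj (F : Type)) (N₁ + N₂) 1 eV (finSum N₁ N₂ J₁ J₂) (Def411WeilCarriers.JW ↥(maximalRealSubfield (F : Type)) (F : Type) a) hcδ hδ hd (isSymm_finSum h₁ h₂) (Def411WeilCarriers.isSymm_TW ↥(maximalRealSubfield (F : Type)) a) hVd (Def411WeilCarriers.isUnit_det_TW ↥(maximalRealSubfield (F : Type)) a) (finSum_eq_map_finSum ↥(maximalRealSubfield (F : Type)) (F : Type) N₁ N₂ J₁ J₂ hJ₁ hJ₂) (Def411WeilCarriers.JW_eq ↥(maximalRealSubfield (F : Type)) (F : Type) a) hs) (Def411WeilCarriers.lineChar ↥(maximalRealSubfield (F : Type)) (F : Type) (IsCMField.complexConj (F : Type)) a χface.1))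
    (hC : ∀ (u : ↥(finAdelic (↥(maximalRealSubfield F)) F (IsCMField.complexConj F) 2 Jstar)) (w : Coinv (finPairRepW ↥(maximalRealSubfield (F : Type)) (F : Type) (IsCMField.complexConj (F : Type)) (N₁ + N₂) 1 eV (finSum N₁ N₂ J₁ J₂) (Def411WeilCarriers.JW ↥(maximalRealSubfield (F : Type)) (F : Type) a) hcδ hδ hd (isSymm_finSum h₁ h₂) (Def411WeilCarriers.isSymm_TW ↥(maximalRealSubfield (F : Type)) a) hVd (Def411WeilCarriers.isUnit_det_TW ↥(maximalRealSubfield (F : Type)) a) (finSum_eq_map_finSum ↥(maximalRealSubfield (F : Type)) (F : Type) N₁ N₂ J₁ J₂ hJ₁ hJ₂) (Def411WeilCarriers.JW_eq ↥(maximalRealSubfield (F : Type)) (F : Type) a) hs) (Def411WeilCarriers.lineChar ↥(maximalRealSubfield (F : Type)) (F : Type) (IsCMField.complexConj (F : Type)) a χface.1)),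
      C.symm (plugRho N₁ N₂ eV J₁ J₂ hcδ hδ hd h₁ h₂ hVd hJ₁ hJ₂ a hs χface θ u w) = ρX u (C.symm w))
    (ψ : ↥(finAdelicOne ↥(maximalRealSubfield (F : Type)) (F : Type) (IsCMField.complexConj (F : Type))) →* (AlgebraicClosure ℚ_[ℓ])ˣ) {v : AlgebraicClosure ℚ_[ℓ] ⊗[ℚ_[ℓ]] (sec42DataGS S h4 isoₛ).etaleH1Tower ℓ}
    (hv : weightProj (rhoEtCenterGSExt S hU7ₛ hLQ h4 isoₛ ℓ (AlgebraicClosure ℚ_[ℓ])) (exists_finiteIndex_forall_rhoEtCenterGSExt_eq S hU7ₛ hLQ h4 isoₛ ℓ (AlgebraicClosure ℚ_[ℓ])) ψ v ≠ 0)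
    {f' : X →ₛₗ[(ι' : ℂ →+* AlgebraicClosure ℚ_[ℓ])] AlgebraicClosure ℚ_[ℓ] ⊗[ℚ_[ℓ]] (sec42DataGS S h4 isoₛ).etaleH1Tower ℓ} (hf' : f' ∈ (etaleHeckeDatumGS S hU7ₛ hLQ h4 isoₛ ℓ).omegaHom ι' ρX) :
    ∃ g : Def411WeilCarriers.omegaAtLine ↥(maximalRealSubfield (F : Type)) (F : Type) (IsCMField.complexConj (F : Type)) N₁ e₁ J₁ hcδ hδ hd h₁ h₁d hJ₁ hs₁f a (chiOfWeight S hU7ₛ hLQ h4 isoₛ ℓ ι' ψ hv) ⊗[ℂ] Coinv (plugRho₂ N₂ e₂ J₂ hcδ hδ hd h₂ h₂d hJ₂ a hs₂) (plugChi N₁ N₂ eV e₁ e₂ J₁ J₂ hcδ hδ hd h₁ h₂ h₁d h₂d hVd hJ₁ hJ₂ a hs hs₁f hs₂ χface * (psiTilde ℓ ι' ψ)⁻¹) →ₛₗ[(ι' : ℂ →+* AlgebraicClosure ℚ_[ℓ])] AlgebraicClosure ℚ_[ℓ] ⊗[ℚ_[ℓ]] (sec42DataGS S h4 isoₛ).etaleH1Tower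 ℓ,
      (∀ w : X, weightProj (rhoEtCenterGSExt S hU7ₛ hLQ h4 isoₛ ℓ (AlgebraicClosure ℚ_[ℓ])) (exists_finiteIndex_forall_rhoEtCenterGSExt_eq S hU7ₛ hLQ h4 isoₛ ℓ (AlgebraicClosure ℚ_[ℓ])) ψ (f' w) =
        g (((((TensorProduct.congr (plugE S hU7ₛ hLQ h4 isoₛ ℓ ι' N₁ e₁ J₁ hcδ hδ hd h₁ h₁d hJ₁ a hs₁f ψ hv) (LinearEquiv.refl ℂ (Coinv (plugRho₂ N₂ e₂ J₂ hcδ hδ hd h₂ h₂d hJ₂ a hs₂) (plugChi N₁ N₂ eV e₁ e₂ J₁ J₂ hcδ hδ hd h₁ h₂ h₁d h₂d hVd hJ₁ hJ₂ a hs hs₁f hs₂ χface * (psiTilde ℓ ι' ψ)⁻¹)))).toLinearMap :) ∘ₗ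
          ((coinvTprodQuot (plugRho₁ N₁ e₁ J₁ hcδ hδ hd h₁ h₁d hJ₁ a hs₁f) (plugRho₂ N₂ e₂ J₂ hcδ hδ hd h₂ h₂d hJ₂ a hs₂) (plugChi N₁ N₂ eV e₁ e₂ J₁ J₂ hcδ hδ hd h₁ h₂ h₁d h₂d hVd hJ₁ hJ₂ a hs hs₁f hs₂ χface) (psiTilde ℓ ι' ψ) :) ∘ₗ
            ((plugPhi N₁ N₂ eV e₁ e₂ J₁ J₂ hcδ hδ hd h₁ h₂ h₁d h₂d hVd hJ₁ hJ₂ a hs hs₁f hs₂ hχV χface).toLinearMap :))) ∘ₗ (C.toLinearMap :)) w)) ∧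
      ∀ m : Coinv (plugRho₂ N₂ e₂ J₂ hcδ hδ hd h₂ h₂d hJ₂ a hs₂) (plugChi N₁ N₂ eV e₁ e₂ J₁ J₂ hcδ hδ hd h₁ h₂ h₁d h₂d hVd hJ₁ hJ₂ a hs hs₁f hs₂ χface * (psiTilde ℓ ι' ψ)⁻¹), g.comp ((TensorProduct.mk ℂ (Def411WeilCarriers.omegaAtLine ↥(maximalRealSubfield (F : Type)) (F : Type) (IsCMField.complexConj (F : Type)) N₁ e₁ J₁ hcδ hδ hd h₁ h₁d hJ₁ hs₁f a (chiOfWeight S hU7ₛ hLQ h4 isoₛ ℓ ι' ψ hv)) (Coinv (plugRho₂ N₂ e₂ J₂ hcδ hδ hd h₂ h₂d hJ₂ a hs₂) (plugChi N₁ N₂ eV e₁ e₂ J₁ J₂ hcδ hδ hd h₁ h₂ h₁d h₂d hVd hJ₁ hJ₂ a hs hs₁f hs₂ χface * (psiTilde ℓ ι' ψ)⁻¹))).flip m) ∈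
        (etaleHeckeDatumGS S hU7ₛ hLQ h4 isoₛ ℓ).omegaHom ι' (plugRho' S hU7ₛ hLQ h4 isoₛ ℓ ι' N₁ e₁ J₁ hcδ hδ hd h₁ h₁d hJ₁ a hs₁f θ ψ hv) := by
  -- `f′ ∘ C⁻¹` is a homomorphism out of the plug representation
  have hf'' : f'.comp C.symm.toLinearMap ∈ (etaleHeckeDatumGS S hU7ₛ hLQ h4 isoₛ ℓ).omegaHom ι' (plugRho N₁ N₂ eV J₁ J₂ hcδ hδ hd h₁ h₂ hVd hJ₁ hJ₂ a hs χface θ) := by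
    intro u w
    rw [LinearMap.comp_apply, LinearEquiv.coe_toLinearMap, hC, hf' u (C.symm w), LinearMap.comp_apply, LinearEquiv.coe_toLinearMap]
  obtain ⟨g, hg', hgmem⟩ := exists_factor_slice_mem_omegaHom_plug' S hU7ₛ hLQ h4 isoₛ ℓ ι' N₁ N₂ eV e₁ e₂ J₁ J₂ hcδ hδ hd h₁ h₂ h₁d h₂d
    hVd hJ₁ hJ₂ a hs hs₁f hs₂ hχV χface θ hθ ψ hv hf''
  refine ⟨g, fun w => ?_, hgmem⟩
  have hw := hg' (C w)
  rw [LinearMap.comp_apply, LinearEquiv.coe_toLinearMap, LinearEquiv.symm_apply_apply] at hw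
  rw [hw]
  rfl

end G2cPlugTail

end Summit.HodgeConjecture.CorCM.Lines.A3Liu418

end
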